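import Literature.Geometry.Manifold.InverseFunctionTheoremRCLike  -- ★ p848579 holomorphic IFT on manifolds (`isLocalDiffeomorphAt_of_mfderiv_rclike`)
import Mathlib.Geometry.Manifold.MFDeriv.Atlas
import Mathlib.Geometry.Manifold.MFDeriv.SpecificFunctions
import Mathlib.Geometry.Manifold.ContMDiff.Constructions
import Mathlib.Geometry.Manifold.ContMDiff.NormedSpace
import Mathlib.Geometry.Manifold.Algebra.LieGroup
import Mathlib.LinearAlgebra.FiniteDimensional.Lemmas
import Mathlib.Analysis.Complex.Basic
import HarnessLib

/-!
# The tubular chart of a `C^ω` family along a section: `p`-adapted holomorphic coordinates straightening the section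
# ([FritzscheGrauert2002] Ch. I §7 Thm. 7.6 (holomorphic inverse function theorem); [LeeSmoothManifolds2013] Thm. 4.5, Thm. 4.26 (rank ∕ slice charts))

Layer `Literature/Geometry/ComplexAnalytic`, namespace `Literature.Geometry.ComplexAnalytic.SectionTubularChart`.  THEOREMS ONLY (no definition, no
named fact, no instance, no notation, no `sorry`).  Cell `hodgecm-mathlib`, «L8-PREP» road B (HOME-only prep for the E-line's printed residue P-1
`relativeExponentialUniformisation`), the first half of organ B2 «LINCHART» of LA7-plan (g2)'s skeleton `StubFLOW.roadB` (`RoadB.LINCHART`), paid by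
LA7-p02 (g2): the `p`-ADAPTED TUBULAR CHART in which the Poincaré–Kœnigs linearisation (★ `KoenigsLinearization`) is then run
(`DoublingLinearisingChart.lean`).  HC_CM is proved only modulo the 7 printed citations until rung 0 closes; generic differential geometry, count-neutral.

SETTING.  Complex manifolds `MA` (model `EA`) and `MS` (model `ES`), a normed space `F` with `dim EA = dim ES + dim F` (all finite-dimensional), a
`C^ω` «projection» `p : MA → MS` with a `C^ω` SECTION `zero : MS → MA` (`p ∘ zero = id`), and at the point `m : MS` a holomorphic map `π : F → MA` INTO
THE FIBRE (`p ∘ π ≡ m`) through `zero m` with injective differential at `0` — so that `range (dπ 0) = ker (dp (zero m))` by dimension count (`dp` is onto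
since `p ∘ zero = id`).  In print: `p` = the analytic projection `A^an → S^an` of an abelian scheme, `zero` its identity section, `π` the uniformisation of
the fibre `A_m(ℂ) = ℂ^g ∕ Λ` ([DeligneHodgeII1971] (4.4.2); road B of the tree's P-1).

RESULT **`exists_sectionTubularChart`**: an `OpenPartialHomeomorph Θ₀ : MA ⇀ ES × F` with `zero m ∈ Θ₀.source`, `C^ω` with `C^ω` inverse (for the models
`𝓘(ℂ, EA)`, `𝓘(ℂ, ES × F)`), FIRST COORDINATE `extChartAt m ∘ p`, STRAIGHTENING THE SECTION: `Θ₀ (zero u) = (extChartAt m u, 0)`, the source saturated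
under `zero ∘ p` and contained in `p ⁻¹' (chartAt m).source`, and conversely `Θ₀.symm (b, 0) = zero ((extChartAt m).symm b)` on the target.
CONSTRUCTION: `K a := (χ (p a), L (φ a) - L (φ (zero (p a))))` with `φ := extChartAt (zero m)`, `χ := extChartAt m` and `L : EA →L[ℂ] F` a left inverse of
`dπ 0` read in `φ`; the differential of `K` at `zero m` is `v ↦ (dp v, L v - L (d(zero) (dp v)))`, injective because `dp v = 0` puts `v` in
`ker dp = range dπ 0` where `L` is injective, hence bijective (`dim EA = dim ES + dim F`); the holomorphic inverse function theorem on manifolds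
(★ `isLocalDiffeomorphAt_of_mfderiv_rclike`) gives the chart, which is then restricted to a `zero ∘ p`-saturated open set.

* §1 linear algebra of the differential (`ker_eq_range_of_comp_eq_zero`, `bijective_prod_sub`);
* §2 **`exists_sectionTubularChart`**.

## References
* [FritzscheGrauert2002] K. Fritzsche, H. Grauert, *From Holomorphic Functions to Complex Manifolds* (2002), Ch. I §7 Thm. 7.6.
* [LeeSmoothManifolds2013] J. M. Lee, *Introduction to Smooth Manifolds*, 2nd ed. (2013), Thm. 4.5 (inverse function theorem), Thm. 4.26.
* [DeligneHodgeII1971] P. Deligne, *Théorie de Hodge II*, Publ. Math. IHÉS 40 (1971), §4.4 (4.4.2) p. 50.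
-/

set_option autoImplicit false

open scoped Manifold ContDiff Topology
open Set Function Filter Module

noncomputable section

namespace Literature.Geometry.ComplexAnalytic.SectionTubularChart

/-! ## §1 Linear algebra of the differential -/

section LinearAlgebra

variable {𝕜 : Type*} [Field 𝕜] {EA ES F : Type*} [AddCommGroup EA] [Module 𝕜 EA] [AddCommGroup ES] [Module 𝕜 ES]
  [AddCommGroup F] [Module 𝕜 F] [FiniteDimensional 𝕜 EA] [FiniteDimensional 𝕜 ES] [FiniteDimensional 𝕜 F]

omit [FiniteDimensional 𝕜 ES] [FiniteDimensional 𝕜 F] in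
/-- If `P : EA → ES` is onto, `D : F → EA` is injective with `P ∘ D = 0`, and `dim EA = dim ES + dim F`, then `ker P = range D`
(rank–nullity). [cite: LeeSmoothManifolds2013, Thm. 4.26 (proof: rank count)] -/
theorem ker_eq_range_of_comp_eq_zero (P : EA →ₗ[𝕜] ES) (D : F →ₗ[𝕜] EA) (hPD : P.comp D = 0) (hP : Surjective P)
    (hD : Injective D) (hdim : finrank 𝕜 EA = finrank 𝕜 ES + finrank 𝕜 F) : LinearMap.ker P = LinearMap.range D := by
  have hle : LinearMap.range D ≤ LinearMap.ker P := by
    rintro _ ⟨w, rfl⟩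
    exact LinearMap.mem_ker.2 (by simpa using LinearMap.congr_fun hPD w)
  refine (Submodule.eq_of_le_of_finrank_eq hle ?_).symm
  have h1 : finrank 𝕜 (LinearMap.range D) = finrank 𝕜 F := LinearMap.finrank_range_of_inj hD
  have h2 := LinearMap.finrank_range_add_finrank_ker P
  have h3 : finrank 𝕜 (LinearMap.range P) = finrank 𝕜 ES := by
    rw [LinearMap.range_eq_top.2 hP, finrank_top]
  omega

/-- The differential of the tubular chart, `v ↦ (P v, L v - L (Z (P v)))`, is BIJECTIVE when `P` is onto, `P ∘ D = 0`, `L ∘ D = id` with `D`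
injective, and `dim EA = dim ES + dim F`. [cite: LeeSmoothManifolds2013, Thm. 4.26 (proof)] -/
theorem bijective_prod_sub (P : EA →ₗ[𝕜] ES) (D : F →ₗ[𝕜] EA) (L : EA →ₗ[𝕜] F) (Z : ES →ₗ[𝕜] EA) (hPD : P.comp D = 0)
    (hP : Surjective P) (hLD : L.comp D = LinearMap.id) (hdim : finrank 𝕜 EA = finrank 𝕜 ES + finrank 𝕜 F) :
    Bijective (P.prod (L - L.comp (Z.comp P))) := by
  have hD : Injective D := fun w w' h ↦ by
    have := congrArg L h
    simpa using (LinearMap.congr_fun hLD w).symm.trans (this.trans (LinearMap.congr_fun hLD w'))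
  have hker := ker_eq_range_of_comp_eq_zero P D hPD hP hD hdim
  have hinj : Injective (P.prod (L - L.comp (Z.comp P))) := by
    refine (injective_iff_map_eq_zero _).2 fun v hv ↦ ?_
    have hPv : P v = 0 := congrArg Prod.fst hv
    have hLv : (L - L.comp (Z.comp P)) v = 0 := congrArg Prod.snd hv
    rw [LinearMap.sub_apply, LinearMap.comp_apply, LinearMap.comp_apply, hPv, map_zero, map_zero, sub_zero] at hLv
    have hvker : v ∈ LinearMap.ker P := LinearMap.mem_ker.2 hPv
    rw [hker] at hvker
    obtain ⟨w, rfl⟩ := hvker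
    have hw : w = 0 := by simpa [hLv] using (LinearMap.congr_fun hLD w).symm
    rw [hw, map_zero]
  have hdim' : finrank 𝕜 EA = finrank 𝕜 (ES × F) := by rw [Module.finrank_prod, hdim]
  exact ⟨hinj, (LinearMap.injective_iff_surjective_of_finrank_eq_finrank hdim').1 hinj⟩

end LinearAlgebra

/-! ## §2 The tubular chart -/

section Chart

variable {EA : Type*} [NormedAddCommGroup EA] [NormedSpace ℂ EA] [FiniteDimensional ℂ EA]
  {ES : Type*} [NormedAddCommGroup ES] [NormedSpace ℂ ES] [FiniteDimensional ℂ ES]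
  {F : Type*} [NormedAddCommGroup F] [NormedSpace ℂ F] [FiniteDimensional ℂ F]
  {MA : Type*} [TopologicalSpace MA] [ChartedSpace EA MA]
  {MS : Type*} [TopologicalSpace MS] [ChartedSpace ES MS]

/-- For the trivial models, a manifold derivative is the derivative of the chart expression (boundaryless: `range 𝓘 = univ`).
[cite: LeeSmoothManifolds2013, Prop. 3.23] -/
theorem hasFDerivAt_writtenInExtChartAt {X : Type*} [TopologicalSpace X] {EX : Type*} [NormedAddCommGroup EX] [NormedSpace ℂ EX]
    [ChartedSpace EX X] {Y : Type*} [TopologicalSpace Y] {EY : Type*} [NormedAddCommGroup EY] [NormedSpace ℂ EY] [ChartedSpace EY Y]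
    {f : X → Y} {x : X} (hf : MDifferentiableAt 𝓘(ℂ, EX) 𝓘(ℂ, EY) f x) :
    HasFDerivAt (extChartAt 𝓘(ℂ, EY) (f x) ∘ f ∘ (extChartAt 𝓘(ℂ, EX) x).symm) (mfderiv 𝓘(ℂ, EX) 𝓘(ℂ, EY) f x)
      (extChartAt 𝓘(ℂ, EX) x x) := by
  have h := hf.hasMFDerivAt.2
  rw [ModelWithCorners.range_eq_univ, hasFDerivWithinAt_univ] at h
  exact h

/-- **THE TUBULAR CHART OF A `C^ω` FAMILY ALONG A SECTION.**  Let `p : MA → MS`, `zero : MS → MA` be `C^ω` with `p ∘ zero = id`,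
`dim EA = dim ES + dim F`, and let `π : F → MA` be differentiable at `0`, through `zero m`, inside the fibre `p ⁻¹ m`, with injective differential
at `0`.  Then there is an open partial homeomorphism `Θ₀ : MA ⇀ ES × F` with `zero m ∈ Θ₀.source`, `C^ω` with `C^ω` inverse, whose first
coordinate is `extChartAt m ∘ p`, which straightens the section (`Θ₀ (zero u) = (extChartAt m u, 0)`, `Θ₀.symm (b, 0) = zero ((extChartAt m).symm b)`),
with source saturated under `zero ∘ p` and lying over the chart domain of `m`. [cite: FritzscheGrauert2002, Ch. I §7 Thm. 7.6]
[cite: LeeSmoothManifolds2013, Thm. 4.5, Thm. 4.26] -/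
theorem exists_sectionTubularChart [IsManifold 𝓘(ℂ, EA) ω MA] [IsManifold 𝓘(ℂ, ES) ω MS]
    (p : MA → MS) (zero : MS → MA) (m : MS)
    (hdim : finrank ℂ EA = finrank ℂ ES + finrank ℂ F)
    (hp : ContMDiff 𝓘(ℂ, EA) 𝓘(ℂ, ES) ω p) (hzero : ContMDiff 𝓘(ℂ, ES) 𝓘(ℂ, EA) ω zero)
    (hp_zero : ∀ u : MS, p (zero u) = u)
    {π : F → MA} (hπd : MDifferentiableAt 𝓘(ℂ, F) 𝓘(ℂ, EA) π 0) (hπ0 : π 0 = zero m) (hpπ : ∀ z : F, p (π z) = m)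
    (hπinj : Injective (mfderiv 𝓘(ℂ, F) 𝓘(ℂ, EA) π 0)) :
    ∃ Θ₀ : OpenPartialHomeomorph MA (ES × F),
      zero m ∈ Θ₀.source ∧
      ContMDiffOn 𝓘(ℂ, EA) 𝓘(ℂ, ES × F) ω Θ₀ Θ₀.source ∧
      ContMDiffOn 𝓘(ℂ, ES × F) 𝓘(ℂ, EA) ω Θ₀.symm Θ₀.target ∧
      (∀ a ∈ Θ₀.source, p a ∈ (chartAt ES m).source) ∧
      (∀ a ∈ Θ₀.source, zero (p a) ∈ Θ₀.source) ∧
      (∀ a ∈ Θ₀.source, (Θ₀ a).1 = extChartAt 𝓘(ℂ, ES) m (p a)) ∧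
      (∀ u : MS, zero u ∈ Θ₀.source → Θ₀ (zero u) = (extChartAt 𝓘(ℂ, ES) m u, 0)) ∧
      (∀ q ∈ Θ₀.target, q.2 = 0 → Θ₀.symm q = zero ((extChartAt 𝓘(ℂ, ES) m).symm q.1)) := by
  haveI : CompleteSpace EA := FiniteDimensional.complete ℂ EA
  set a₀ : MA := zero m with ha₀
  set φ := extChartAt 𝓘(ℂ, EA) a₀ with hφ
  set χ := extChartAt 𝓘(ℂ, ES) m with hχ
  have hpa₀ : p a₀ = m := hp_zero m
  /- the derivatives at the base points, as derivatives of chart expressions -/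
  have hpd : MDifferentiableAt 𝓘(ℂ, EA) 𝓘(ℂ, ES) p a₀ := hp.mdifferentiableAt (by simp)
  have hzd : MDifferentiableAt 𝓘(ℂ, ES) 𝓘(ℂ, EA) zero m := hzero.mdifferentiableAt (by simp)
  set P : EA →L[ℂ] ES := mfderiv 𝓘(ℂ, EA) 𝓘(ℂ, ES) p a₀ with hP
  set Z : ES →L[ℂ] EA := mfderiv 𝓘(ℂ, ES) 𝓘(ℂ, EA) zero m with hZ
  set D : F →L[ℂ] EA := mfderiv 𝓘(ℂ, F) 𝓘(ℂ, EA) π 0 with hD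
  have hPder : HasFDerivAt (χ ∘ p ∘ φ.symm) P (φ a₀) := by
    have h := hasFDerivAt_writtenInExtChartAt hpd
    rwa [hpa₀] at h
  have hZder : HasFDerivAt (φ ∘ zero ∘ χ.symm) Z (χ m) := hasFDerivAt_writtenInExtChartAt hzd
  have hDder : HasFDerivAt (φ ∘ π) D 0 := by
    have h := hasFDerivAt_writtenInExtChartAt hπd
    rw [hπ0, extChartAt_model_space_eq_id] at h
    exact h
  /- the two chain rules: `P ∘ D = 0` (the fibre is contracted) and `P ∘ Z = id` (the section) -/
  have hπcont : ContinuousAt π 0 := hπd.continuousAt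
  have hφsrc : φ.source ∈ 𝓝 a₀ := extChartAt_source_mem_nhds a₀
  have hPD : P.comp D = 0 := by
    have h1 : HasFDerivAt ((χ ∘ p ∘ φ.symm) ∘ (φ ∘ π)) (P.comp D) 0 := by
      refine HasFDerivAt.comp 0 ?_ hDder
      simp only [comp_apply, hπ0]
      exact hPder
    have h2 : ((χ ∘ p ∘ φ.symm) ∘ (φ ∘ π)) =ᶠ[𝓝 0] fun _ ↦ χ m := by
      have hev : ∀ᶠ z in 𝓝 (0 : F), π z ∈ φ.source := hπcont.preimage_mem_nhds (by rw [hπ0]; exact hφsrc)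
      filter_upwards [hev] with z hz
      simp only [comp_apply, φ.left_inv hz, hpπ z]
    exact h1.unique ((hasFDerivAt_const (χ m) (0 : F)).congr_of_eventuallyEq h2)
  have hPZ : P.comp Z = ContinuousLinearMap.id ℂ ES := by
    have hζ0 : (φ ∘ zero ∘ χ.symm) (χ m) = φ a₀ := by simp only [comp_apply, hχ, extChartAt_to_inv, ha₀]
    have h1 : HasFDerivAt ((χ ∘ p ∘ φ.symm) ∘ (φ ∘ zero ∘ χ.symm)) (P.comp Z) (χ m) := by
      refine HasFDerivAt.comp (χ m) ?_ hZder
      rw [hζ0]; exact hPder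
    have h2 : ((χ ∘ p ∘ φ.symm) ∘ (φ ∘ zero ∘ χ.symm)) =ᶠ[𝓝 (χ m)] id := by
      have hcont : ContinuousAt (zero ∘ χ.symm) (χ m) := by
        refine ContinuousAt.comp ?_ (continuousAt_extChartAt_symm m)
        rw [hχ, extChartAt_to_inv]; exact hzero.continuous.continuousAt
      have hev1 : ∀ᶠ y in 𝓝 (χ m), zero (χ.symm y) ∈ φ.source :=
        hcont.preimage_mem_nhds (by simp only [comp_apply, hχ, extChartAt_to_inv]; exact hφsrc)
      have hev2 : ∀ᶠ y in 𝓝 (χ m), y ∈ χ.target := extChartAt_target_mem_nhds m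
      filter_upwards [hev1, hev2] with y hy1 hy2
      simp only [comp_apply, φ.left_inv hy1, hp_zero, χ.right_inv hy2, id]
    exact h1.unique ((hasFDerivAt_id (χ m)).congr_of_eventuallyEq h2)
  have hPsurj : Surjective P := fun w ↦ ⟨Z w, by simpa using ContinuousLinearMap.ext_iff.1 hPZ w⟩
  /- a left inverse `L` of `D = dπ 0` -/
  obtain ⟨Lₗ, hLₗ⟩ := LinearMap.exists_leftInverse_of_injective (D : F →ₗ[ℂ] EA) (LinearMap.ker_eq_bot.2 hπinj)
  set L : EA →L[ℂ] F := LinearMap.toContinuousLinearMap Lₗ with hL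
  have hLD : (L : EA →ₗ[ℂ] F).comp (D : F →ₗ[ℂ] EA) = LinearMap.id := by
    rw [hL, LinearMap.coe_toContinuousLinearMap]; exact hLₗ
  /- the candidate chart `K` and its differential -/
  set K : MA → ES × F := fun a ↦ (χ (p a), L (φ a) - L (φ (zero (p a)))) with hK
  set M' : EA →L[ℂ] ES × F := P.prod (L - L.comp (Z.comp P)) with hM'
  have hM'bij : Bijective M' := by
    have h := bijective_prod_sub (P : EA →ₗ[ℂ] ES) (D : F →ₗ[ℂ] EA) (L : EA →ₗ[ℂ] F) (Z : ES →ₗ[ℂ] EA)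
      (congrArg ContinuousLinearMap.toLinearMap hPD) hPsurj hLD hdim
    convert h using 1
    rfl
  let f' : EA ≃L[ℂ] ES × F := LinearEquiv.toContinuousLinearEquiv (LinearEquiv.ofBijective (M' : EA →ₗ[ℂ] ES × F) hM'bij)
  have hf'M : (f' : EA →L[ℂ] ES × F) = M' := by ext v <;> rfl
  /- the open set where `K` is `C^ω` -/
  set U₀ : Set MA := (chartAt EA a₀).source ∩ p ⁻¹' (chartAt ES m).source ∩ (zero ∘ p) ⁻¹' (chartAt EA a₀).source with hU₀
  have hU₀open : IsOpen U₀ :=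
    ((chartAt EA a₀).open_source.inter ((chartAt ES m).open_source.preimage hp.continuous)).inter
      ((chartAt EA a₀).open_source.preimage (hzero.continuous.comp hp.continuous))
  have ha₀U₀ : a₀ ∈ U₀ := by
    refine ⟨⟨mem_chart_source EA a₀, ?_⟩, ?_⟩
    · show p a₀ ∈ (chartAt ES m).source
      rw [hpa₀]; exact mem_chart_source ES m
    · show zero (p a₀) ∈ (chartAt EA a₀).source
      rw [hpa₀]; exact mem_chart_source EA a₀
  have hKω : ContMDiffOn 𝓘(ℂ, EA) 𝓘(ℂ, ES × F) ω K U₀ := by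
    have h1 : ContMDiffOn 𝓘(ℂ, EA) 𝓘(ℂ, ES) ω (fun a ↦ χ (p a)) U₀ :=
      (contMDiffOn_extChartAt.comp hp.contMDiffOn (fun a ha ↦ ha)).mono fun a ha ↦ ha.1.2
    have h2 : ContMDiffOn 𝓘(ℂ, EA) 𝓘(ℂ, F) ω (fun a ↦ L (φ a)) U₀ :=
      (L.contMDiff.comp_contMDiffOn contMDiffOn_extChartAt).mono fun a ha ↦ ha.1.1
    have h3 : ContMDiffOn 𝓘(ℂ, EA) 𝓘(ℂ, F) ω (fun a ↦ L (φ (zero (p a)))) U₀ := by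
      have h := L.contMDiff.comp_contMDiffOn
        (contMDiffOn_extChartAt.comp (hzero.comp hp).contMDiffOn (fun a (ha : a ∈ (zero ∘ p) ⁻¹' (chartAt EA a₀).source) ↦ ha))
      exact h.mono fun a ha ↦ ha.2
    exact h1.prodMk_space (h2.sub h3)
  /- `mfderiv K a₀ = M'` -/
  have hKd : MDifferentiableAt 𝓘(ℂ, EA) 𝓘(ℂ, ES × F) K a₀ :=
    (hKω.contMDiffAt (hU₀open.mem_nhds ha₀U₀)).mdifferentiableAt (by simp)
  have hKder : HasFDerivAt (K ∘ φ.symm) M' (φ a₀) := by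
    -- near `φ a₀`, `K ∘ φ.symm x = (b x, L x - L (ζ (b x)))` with `b = χ ∘ p ∘ φ.symm`, `ζ = φ ∘ zero ∘ χ.symm`
    have hb0 : (χ ∘ p ∘ φ.symm) (φ a₀) = χ m := by simp only [comp_apply, hφ, extChartAt_to_inv, hpa₀]
    have hζ : HasFDerivAt ((φ ∘ zero ∘ χ.symm) ∘ (χ ∘ p ∘ φ.symm)) (Z.comp P) (φ a₀) := by
      refine HasFDerivAt.comp (φ a₀) ?_ hPder
      rw [hb0]; exact hZder
    have hmain : HasFDerivAt (fun x ↦ ((χ ∘ p ∘ φ.symm) x, L x - L (((φ ∘ zero ∘ χ.symm) ∘ (χ ∘ p ∘ φ.symm)) x))) M' (φ a₀) := by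
      rw [hM']
      exact hPder.prodMk ((L.hasFDerivAt).sub (L.hasFDerivAt.comp (φ a₀) hζ))
    refine hmain.congr_of_eventuallyEq ?_
    have hev1 : ∀ᶠ x in 𝓝 (φ a₀), x ∈ φ.target := extChartAt_target_mem_nhds a₀
    have hev2 : ∀ᶠ x in 𝓝 (φ a₀), φ.symm x ∈ U₀ :=
      (continuousAt_extChartAt_symm a₀).preimage_mem_nhds (by rw [extChartAt_to_inv]; exact hU₀open.mem_nhds ha₀U₀)
    filter_upwards [hev1, hev2] with x hx1 hx2
    have hpx : p (φ.symm x) ∈ (chartAt ES m).source := hx2.1.2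
    simp only [hK, comp_apply]
    rw [φ.right_inv hx1, χ.left_inv (by rw [hχ, extChartAt_source]; exact hpx)]
  have hmf : mfderiv 𝓘(ℂ, EA) 𝓘(ℂ, ES × F) K a₀ = (f' : EA →L[ℂ] ES × F) := by
    rw [hf'M, hKd.mfderiv, ModelWithCorners.range_eq_univ, fderivWithin_univ]
    have hw : writtenInExtChartAt 𝓘(ℂ, EA) 𝓘(ℂ, ES × F) a₀ K = K ∘ φ.symm := by
      funext x
      simp only [writtenInExtChartAt, extChartAt_model_space_eq_id, PartialEquiv.refl_coe, comp_apply, id_eq, hφ]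
    rw [hw]
    exact hKder.fderiv
  /- the inverse function theorem on manifolds -/
  obtain ⟨Φ, ha₀Φ, hKΦ⟩ := Literature.Geometry.Manifold.isLocalDiffeomorphAt_of_mfderiv_rclike (𝕜 := ℂ)
    (I := 𝓘(ℂ, EA)) (J := 𝓘(ℂ, ES × F)) (n := ω) (by simp) hU₀open ha₀U₀ hKω f' hmf
  /- restriction to a `zero ∘ p`-saturated open set inside `U₀` -/
  set S : Set MA := Φ.source ∩ U₀ with hS
  have hSopen : IsOpen S := Φ.open_source.inter hU₀open
  set S' : Set MA := S ∩ (zero ∘ p) ⁻¹' S with hS'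
  have hS'open : IsOpen S' := hSopen.inter (hSopen.preimage (hzero.continuous.comp hp.continuous))
  have ha₀S : a₀ ∈ S := ⟨ha₀Φ, ha₀U₀⟩
  have ha₀S' : a₀ ∈ S' := ⟨ha₀S, by show zero (p a₀) ∈ S; rw [hpa₀]; exact ha₀S⟩
  have hsat : ∀ a ∈ S', zero (p a) ∈ S' := fun a ha ↦
    ⟨ha.2, by show zero (p (zero (p a))) ∈ S; rw [hp_zero]; exact ha.2⟩
  let Θ₀ : OpenPartialHomeomorph MA (ES × F) := Φ.toOpenPartialHomeomorph.restrOpen S' hS'open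
  have hΘ₀src : Θ₀.source = Φ.source ∩ S' := rfl
  have hΘ₀K : ∀ a ∈ Θ₀.source, Θ₀ a = K a := fun a ha ↦ (hKΦ ha.1).symm
  have hKzero : ∀ u : MS, K (zero u) = (χ u, 0) := fun u ↦ by
    simp only [hK, hp_zero, sub_self]
  refine ⟨Θ₀, ⟨ha₀Φ, ha₀S'⟩, ?_, ?_, fun a ha ↦ ha.2.1.2.1.2, fun a ha ↦ ⟨(hsat a ha.2).1.1, hsat a ha.2⟩, fun a ha ↦ ?_,
    fun u hu ↦ ?_, fun q hq hq2 ↦ ?_⟩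
  · exact Φ.contMDiffOn_toFun.mono fun a ha ↦ ha.1
  · intro q hq
    exact (Φ.contMDiffOn_invFun q hq.1).mono fun q' hq' ↦ hq'.1
  · rw [hΘ₀K a ha]
  · rw [hΘ₀K _ hu, hKzero]
  · -- `q = (b, 0)` in the target: `Θ₀.symm q` and `zero (p (Θ₀.symm q))` are both sent to `q`
    have ha : Θ₀.symm q ∈ Θ₀.source := Θ₀.map_target hq
    have hza : zero (p (Θ₀.symm q)) ∈ Θ₀.source := ⟨(hsat _ ha.2).1.1, hsat _ ha.2⟩
    have h2 : q.1 = χ (p (Θ₀.symm q)) := by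
      have h := congrArg Prod.fst (hΘ₀K _ ha)
      rw [Θ₀.right_inv hq] at h
      exact h
    have h1 : Θ₀ (zero (p (Θ₀.symm q))) = q := by
      rw [hΘ₀K _ hza, hKzero]
      exact Prod.ext h2.symm hq2.symm
    have h3 : zero (p (Θ₀.symm q)) = Θ₀.symm q :=
      Θ₀.injOn hza ha (by rw [h1]; exact (Θ₀.right_inv hq).symm)
    have h4 : χ.symm q.1 = p (Θ₀.symm q) := by
      rw [h2]; exact χ.left_inv (by rw [hχ, extChartAt_source]; exact ha.2.1.2.1.2)
    rw [h4, h3]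

end Chart

end Literature.Geometry.ComplexAnalytic.SectionTubularChart

end
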